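import Mathlib
import HarnessLib
import Summits.HubbardSuperconductivity.HubbardSuperconductivity.Theorems.KLProgrammeKLRegimeSplitEdgeFacts

/-!
# Route `KLProgramme` — crux K3, ENGINE child (gen 4 `KLRegimeEngineV12`, stmt-HubbardSuperconductivity-19855): the total-variation bound of
# `…SplitEdgeFacts` §6 for MIXED slice pairs — one leg in slice `n`, the partner in another multiplier family (cell gate-hubbard-kl, seat p1 g7)

The FULL step-`n` rung weight of the exact one-step ladder identity is `B_{≥n} − B_{≥n−1} = diag(z^{nn} + z^{n>} + z^{>n})` (same-slice pair plus the
two MIXED pairs with the already-integrated covariance `C^K_{>Λ_{n−1}}`; HOME/STATUS p1 g7 2026-08-27T00:11:57Z ENGINE NOTE).  §6 of `…SplitEdgeFacts`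
(`kled_sum_norm_pairWeight_le_mass`) bounds the total variation of `z^{nn}` by the `Q = 0` slice mass; this file is the two-family twin:
`kled_sum_norm_mixedPairWeight_le` — `Σ_{p,i} ‖c·a(i,p)·b(σ i, τ p)/((i·freq i − e p)(−i·freq i − e (τ p)))‖ ≤ (c/2)·(M_a + M_b)`, `M_f = Σ_{p,i} f(i,p)²/(freq i² + (e p)²)`
(AM–GM + the reindexing `(i,p) ↦ (σ i, τ p)`), so the (m) conjunct of (E2-v8) for the full weight is `M_n + Σ_{m reachable} (M_n + M_m)` — each mass
sign-blind by §7 (`kled_mass_le_card_mul_card`), the reachable partner slices being `m ∈ {n−4,…,n−1}` by support geometry (`…SplitFrameEnergyGap`).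
Pure real/complex arithmetic; nothing about the model is asserted.
-/

noncomputable section

namespace Summit.HubbardSuperconductivity.HubbardSuperconductivity.Theorems.KLRegimeSplit

set_option linter.dupNamespace false -- summit = problem name (single-conjunct summit), D-0017

open Real Finset Complex

section Mixed

variable {P F : Type*} [Fintype P] [Fintype F]

/-- **Total variation of MIXED slice pair weights**: with two multiplier families `a` (slice `n`) and `b` (the partner),
`Σ_{p,i} ‖c·a(i,p)·b(σ i, τ p)/((i·freq i − e p)(−i·freq i − e (τ p)))‖ ≤ (c/2)·(Σ_{p,i} a(i,p)²/(freq i² + (e p)²) + Σ_{p,i} b(i,p)²/(freq i² + (e p)²))`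
for `c ≥ 0` and a frequency reflection `freq (σ i) = −freq i` (`a = b` is `kled_sum_norm_pairWeight_le_mass`). -/
theorem kled_sum_norm_mixedPairWeight_le (τ : P ≃ P) (σ : F ≃ F) (freq : F → ℝ) (hfreq : ∀ i, freq (σ i) = -freq i)
    (e : P → ℝ) (a b : F → P → ℝ) {c : ℝ} (hc : 0 ≤ c) :
    ∑ p, ∑ i, ‖(c : ℂ) * ((a i p * b (σ i) (τ p) : ℝ) : ℂ) / ((I * freq i - e p) * (-I * freq i - e (τ p)))‖ ≤
      c / 2 * (∑ p, ∑ i, a i p ^ 2 / (freq i ^ 2 + e p ^ 2) + ∑ p, ∑ i, b i p ^ 2 / (freq i ^ 2 + e p ^ 2)) := by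
  set ma : F → P → ℝ := fun i p => a i p ^ 2 / (freq i ^ 2 + e p ^ 2) with hma_def
  set mb : F → P → ℝ := fun i p => b i p ^ 2 / (freq i ^ 2 + e p ^ 2) with hmb_def
  have hterm : ∀ p i, ‖(c : ℂ) * ((a i p * b (σ i) (τ p) : ℝ) : ℂ) / ((I * freq i - e p) * (-I * freq i - e (τ p)))‖ ≤
      c / 2 * (ma i p + mb (σ i) (τ p)) := by
    intro p i
    refine (kled_norm_pairWeight_le_amgm hc _ _).trans (le_of_eq ?_)
    rw [kled_norm_sq_I_mul_sub, kled_norm_sq_neg_I_mul_sub, hma_def, hmb_def]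
    simp only [hfreq, neg_sq]
  have hreindex : ∑ p, ∑ i, mb (σ i) (τ p) = ∑ p, ∑ i, mb i p := by
    calc ∑ p, ∑ i, mb (σ i) (τ p) = ∑ p, ∑ i, mb i (τ p) := sum_congr rfl fun p _ => Equiv.sum_comp σ (fun i => mb i (τ p))
      _ = ∑ p, ∑ i, mb i p := Equiv.sum_comp τ (fun p => ∑ i, mb i p)
  calc ∑ p, ∑ i, ‖(c : ℂ) * ((a i p * b (σ i) (τ p) : ℝ) : ℂ) / ((I * freq i - e p) * (-I * freq i - e (τ p)))‖
      ≤ ∑ p, ∑ i, c / 2 * (ma i p + mb (σ i) (τ p)) := sum_le_sum fun p _ => sum_le_sum fun i _ => hterm p i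
    _ = c / 2 * (∑ p, ∑ i, ma i p + ∑ p, ∑ i, mb (σ i) (τ p)) := by
        rw [mul_add, mul_sum, mul_sum, ← sum_add_distrib]
        refine sum_congr rfl fun p _ => ?_
        rw [mul_sum, mul_sum, ← sum_add_distrib]
        exact sum_congr rfl fun i _ => by ring
    _ = c / 2 * (∑ p, ∑ i, ma i p + ∑ p, ∑ i, mb i p) := by rw [hreindex]

/-- **The aggregated mixed weight has the same total-variation bound** (`|Re Σ_i| ≤ Σ_i ‖·‖`). -/
theorem kled_sum_abs_aggregatedMixed_le (τ : P ≃ P) (σ : F ≃ F) (freq : F → ℝ) (hfreq : ∀ i, freq (σ i) = -freq i)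
    (e : P → ℝ) (a b : F → P → ℝ) {c : ℝ} (hc : 0 ≤ c) {w : P → ℝ}
    (hw : ∀ p, w p = (∑ i, (c : ℂ) * ((a i p * b (σ i) (τ p) : ℝ) : ℂ) / ((I * freq i - e p) * (-I * freq i - e (τ p)))).re) :
    ∑ p, |w p| ≤ c / 2 * (∑ p, ∑ i, a i p ^ 2 / (freq i ^ 2 + e p ^ 2) + ∑ p, ∑ i, b i p ^ 2 / (freq i ^ 2 + e p ^ 2)) := by
  refine le_trans (sum_le_sum fun p _ => ?_) (kled_sum_norm_mixedPairWeight_le τ σ freq hfreq e a b hc)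
  rw [hw p, re_sum]
  exact (abs_sum_le_sum_abs _ _).trans (sum_le_sum fun i _ => Complex.abs_re_le_norm _)

end Mixed

end Summit.HubbardSuperconductivity.HubbardSuperconductivity.Theorems.KLRegimeSplit

end
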